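import Summits.QuantumFields.YangMills.Theorems.UnitScaleTiltFluctuationComparisonRegPrGlobalSlackCanonicalEndToEnd
import Summits.QuantumFields.YangMills.Theorems.UnitScaleTiltFluctuationComparisonRegPrGlobalSlackKernelRescaleHonest
import HarnessLib

/-!
# `UnitScaleTiltFluctuationComparisonRegPrGlobalSlackCanonicalEndToEndHonest` — STUB 3⁗ FROM THE SIX CHART ROWS IN THE DISPLAYED (HONEST) CURRENCY AT THE CANONICAL
# POLYMERISATION, BY NAME (crux `FluctuationComparisonRegPrL`, stmt-QuantumFields-19935, STUB 3⁗ `stub_globalTwoRunSlackFam`; width-lever lane A, capstone, honest form)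

Seat ym-ust-19935-slack g0 (prover).  `…CanonicalEndToEnd.K1aChartLine` removed the five producer rows from `K1aLine` (theorems for `canonPolymer p`/`canonPT p`);
`GlobalSlackKernelRescale.K1aLineHonest`/`k1aLine_of_honest` (port of ym-cruxidea-19201-1 g14, F-idea1-g14-1) replaced the three display-located chart rows by their
HONEST forms — `KernelSizeΦg` (kernel size WITH the birth coupling), `CfgSizeΦr`/`CfgCauchyΦr` ((28) WITH the collar polylogarithm `r(g_b)` at the record's `r₀`).
This file does both at once:

* **`K1aChartLineHonest L 𝔠 a₀ a₁ a`** — the six chart rows in honest currency at `dataOfV3 p (canonPolymer p)` / `canonPT p`, plus the same located letters and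
  windows as `K1aChartLine`;
* **`k1aLineHonest_of_chartLineHonest : K1aChartLineHonest L 𝔠 a₀ a₁ a → K1aLineHonest L 𝔠 a₀ a₁ a`** (the five producer theorems);
* **`globalTwoRunSlackFam_of_k1aChartLineHonest`**: `(∀ L …, ∃ a, 0 < a ∧ a < 1 ∧ K1aChartLineHonest L 𝔠 a₀ a₁ a) →` THE REGISTERED TEXT OF `stub_globalTwoRunSlackFam`
  VERBATIM (`= globalTwoRunSlackFam_of_k1aLineHonest ∘ k1aLineHonest_of_chartLineHonest`, rate `a/2`);
* §2 window-free: **`K1aChartRowsHonest`** (six honest chart rows + letters, NO windows), `k1aChartLineHonest_of_chartRowsHonest`, **`globalTwoRunSlackFam_of_k1aChartRowsHonest`**.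
Every `def` is a hypothesis schema; nothing of [Balaban1985UV3]/[King1986] is asserted.

References: T. Bałaban, CMP 102 (1985) 255–275 [Balaban1985UV3] ((7) p.257, (24)–(25) p.262, (28)–(30) p.263, (33)–(34) p.264, (43)–(46) pp.266–267, (57)–(61)
pp.270–271); C. King, CMP 102 (1986) 649–677 [King1986] (Thm 3.4 (3.9) p.656, Prop. 3.6 (3.55)–(3.56) p.662, Prop. 3.9 (3.71)–(3.74) p.665).
-/

set_option autoImplicit false

noncomputable section

namespace Summit.QuantumFields.YangMills.Theorems.GlobalSlackCanonicalPolymers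

open scoped BigOperators
open Literature.MathematicalPhysics.QuantumFieldTheory.Balaban1983to89
open Literature.MathematicalPhysics.QuantumFieldTheory.Balaban1983to89.T3ContinuumYM3Torus
open Literature.MathematicalPhysics.QuantumFieldTheory.Balaban1983to89.T3UnitScaleTilt (θBal)
open Literature.MathematicalPhysics.QuantumFieldTheory.Balaban1983to89.T3AlphaInputsAC
open Literature.MathematicalPhysics.QuantumFieldTheory.Balaban1983to89.T3AlphaInputsACTwoRun
open Literature.MathematicalPhysics.QuantumFieldTheory.Balaban1983to89.T3AlphaInputsACTwoRunLevel
open Literature.MathematicalPhysics.QuantumFieldTheory.Balaban1983to89.B12TreeDecay (kappa₀ K₀ K₀_pos)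
open Literature.MathematicalPhysics.QuantumFieldTheory.Balaban1985CMP102
open Literature.MathematicalPhysics.QuantumFieldTheory.Balaban1985CMP102.Setting
open Summit.QuantumFields.Balaban3D.Carriers
open Summit.QuantumFields.Balaban3D.Proofs.Primitives
open Summit.QuantumFields.Balaban3D.Proofs.GroupModelLieC (lieC)
open Summit.QuantumFields.YangMills.Theorems
open Summit.QuantumFields.YangMills.Theorems.GlobalSlack (GlobalSupRateTSlack)
open Summit.QuantumFields.YangMills.Theorems.GlobalSlackKernelMatching
open Summit.QuantumFields.YangMills.Theorems.GlobalSlackKernelRescale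

/-! ## §1 The honest chart line -/

/-- **THE K1a CHART LINE AT THE CANONICAL POLYMERISATION, HONEST CURRENCY** — `K1aChartLine` with `KernelSizeΦ`, `CfgSizeΦ`, `CfgCauchyΦ` replaced by the display-located
honest rows `KernelSizeΦg` (with the birth coupling `g_b`), `CfgSizeΦr`, `CfgCauchyΦr` (with (28)'s collar polylogarithm `r(g_b)` at the record's `r₀`); the other three
chart rows (`TaylorSplitΦ`, K1a `FlatKernelCauchyΦ`, `RemainderSmallΦ`), the windows and the located letters verbatim.  Hypothesis schema; never asserted.
[cite: Balaban1985UV3, (7) p.257, (25) p.262, (28) p.263, (34) p.264, (43)-(46) pp.266-267; King1986, Prop. 3.6 (3.56) p.662, Prop. 3.9 (3.71) p.665] -/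
def K1aChartLineHonest (L : ℕ) (𝔠 : AlphaConsts L (suGroupModel 2).N) (a₀ a₁ a : ℝ) : Prop :=
  ∃ (κ C C_E C_R C_s C_B γB : ℝ), 0 < κ ∧ κ ≤ 𝔠.κ ∧ kappa₀ (4 * 2 ^ 3) (2 * 3) ≤ κ ∧ 0 ≤ C ∧ 0 ≤ C_E ∧ 0 ≤ C_R ∧ 0 ≤ C_s ∧ 0 ≤ C_B ∧ 0 < γB ∧
    L ≤ 𝔠.M₁ ∧
    ∀ (F : T3Family) (γ : ℝ) (hF : F.L = L) (hγ : 0 < γ), γ ≤ γB → ∀ (hγ1 : γ ≤ (min (hF ▸ 𝔠).gamma0 1) ^ 2),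
      AlphaInputsT3AC.OfV3At F (hF ▸ 𝔠) a₀ a₁ →
        (∀ n, (C_s + C_B) * θBal F.L γ (hF ▸ 𝔠).b₀ (hF ▸ 𝔠).p₀ n ≤ 1) ∧
        (∀ K k, k + 1 ≤ K → (hF ▸ 𝔠).cB * (B10.rFun (hF ▸ 𝔠).r₀ ((SK F (hF ▸ 𝔠) γ hγ hγ1 K).gk k) * (SK F (hF ▸ 𝔠) γ hγ hγ1 K).gk k *
            B10.pFun (hF ▸ 𝔠).b₀ (hF ▸ 𝔠).p₀ ((SK F (hF ▸ 𝔠) γ hγ hγ1 K).gk k)) ≤ (hF ▸ 𝔠).ρ / 4) ∧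
        (∀ K k, k + 1 ≤ K → 8 * (F.L : ℝ) ^ 2 * (hF ▸ 𝔠).B₃ * (hF ▸ 𝔠).Zfull *
            ((SK F (hF ▸ 𝔠) γ hγ hγ1 K).gk k * B10.pFun (hF ▸ 𝔠).b₀ (hF ▸ 𝔠).p₀ ((SK F (hF ▸ 𝔠) γ hγ hγ1 K).gk k)) ≤ 1 / 2) ∧
        ∃ (p : ∀ K, AlphaInputsT3AC.PkgAtV3 F (hF ▸ 𝔠) γ hγ hγ1 K), (∀ K, (p K).a₀ = a₀ ∧ (p K).a₁ = a₁) ∧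
          ∃ (Φ : ChartFam ↥(lieC (suGroupModel 2)) F) (e : VacFam F) (B : CfgFam ↥(lieC (suGroupModel 2)) F) (R : RemFam F),
            TaylorSplitΦ (canonPT p) Φ e B R ∧ FlatKernelCauchyΦ (AlphaInputsT3AC.dataOfV3 p (canonPolymer p)) Φ κ a C ∧
            KernelSizeΦg (AlphaInputsT3AC.dataOfV3 p (canonPolymer p)) Φ κ C_E ∧
            RemainderSmallΦ (AlphaInputsT3AC.dataOfV3 p (canonPolymer p)) R (hF ▸ 𝔠).b₀ (hF ▸ 𝔠).p₀ κ C_R ∧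
            CfgSizeΦr (AlphaInputsT3AC.dataOfV3 p (canonPolymer p)) B (hF ▸ 𝔠).b₀ (hF ▸ 𝔠).p₀ (hF ▸ 𝔠).r₀ C_s ∧
            CfgCauchyΦr (AlphaInputsT3AC.dataOfV3 p (canonPolymer p)) B (hF ▸ 𝔠).b₀ (hF ▸ 𝔠).p₀ (hF ▸ 𝔠).r₀ a C_B fun _ => 1

/-- **THE HONEST CHART LINE GIVES THE HONEST K1a LINE** (the five producer rows supplied by `pintDecompTrivT_canon`, `locCover_canon`, `locBlockVolume_canon`,
`locMatched_canon`, `termSizeTrivT_canon` for `π := canonPolymer p`, `PT := canonPT p`). [cite: Balaban1985UV3, (24)-(25) p.262, (43)-(46) pp.266-267, (59) p.270; Balaban1987RG1, (0.1) p.251] -/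
theorem k1aLineHonest_of_chartLineHonest {L : ℕ} {𝔠 : AlphaConsts L (suGroupModel 2).N} {a₀ a₁ a : ℝ} (h : K1aChartLineHonest L 𝔠 a₀ a₁ a) :
    K1aLineHonest L 𝔠 a₀ a₁ a := by
  obtain ⟨κ, C, C_E, C_R, C_s, C_B, γB, hκ0, hκle, hκ₀, hC, hCE, hCR, hCs, hCB, hγB, hM, hall⟩ := h
  refine ⟨κ, C, C_E, C_R, C_s, C_B, max (newConstL L 𝔠) (oldConstL L 𝔠 * (L : ℝ) ^ 4), max 1 (K₀ (4 * 2 ^ 3) (2 * 3)), γB,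
    hC, hCE, hCR, hCs, hCB, le_max_of_le_left (newConstL_nonneg L 𝔠), hγB, fun F γ hF hγ hγle hγ1 hOf => ?_⟩
  subst hF
  obtain ⟨hwin, hw1, hw2, p, hp, Φ, e, B, R, hT, hK, hE, hR, hS, hBC⟩ := hall F γ rfl hγ hγle hγ1 hOf
  exact ⟨hwin, p, hp, canonPolymer p, canonPT p, Φ, e, B, R, pintDecompTrivT_canon p, locCover_canon p hκ0.le hκ₀, locBlockVolume_canon p hM,
    locMatched_canon p, termSizeTrivT_canon p hM hκ0 hκle hw1 hw2, hT, hK, hE, hR, hS, hBC⟩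

/-- **THE REGISTERED STUB 3⁗ FROM THE SIX HONEST CHART ROWS AT THE CANONICAL POLYMERISATION, BY NAME** (`globalTwoRunSlackFam_of_k1aLineHonest ∘
k1aLineHonest_of_chartLineHonest`; rate `a/2`, σ = 7, profile `θBal(b₀,p₀)`, no letter of record re-typed). [cite: King1986, Thm 3.4 (3.9) p.656, Prop. 3.6 p.662; Balaban1985UV3, (7) p.257, (28) p.263, (34) p.264, (43)-(46) pp.266-267, (57) p.270] -/
theorem globalTwoRunSlackFam_of_k1aChartLineHonest
    (h : ∀ (L : ℕ), Odd L → 7 ≤ L → ∀ (𝔠 : AlphaConsts L (suGroupModel 2).N) (a₀ a₁ : ℝ), 0 < a₀ → 0 < a₁ → 𝔠.B₃ * a₁ ≤ a₀ →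
      ∃ a : ℝ, 0 < a ∧ a < 1 ∧ K1aChartLineHonest L 𝔠 a₀ a₁ a) :
    ∀ (L : ℕ), Odd L → 7 ≤ L → ∀ (𝔠 : Summit.QuantumFields.Balaban3D.Proofs.Primitives.AlphaConsts L (Summit.QuantumFields.Balaban3D.Carriers.suGroupModel 2).N)
      (a₀ a₁ : ℝ), 0 < a₀ → 0 < a₁ → 𝔠.B₃ * a₁ ≤ a₀ →
      ∃ a : ℝ, 0 < a ∧ ∃ γB : ℝ, 0 < γB ∧ ∀ (F : T3Family) (γ : ℝ) (hF : F.L = L) (hγ : 0 < γ), γ ≤ γB →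
        ∀ (hγ1 : γ ≤ (min (hF ▸ 𝔠).gamma0 1) ^ 2),
          Summit.QuantumFields.YangMills.Theorems.AlphaInputsT3AC.OfV3At F (hF ▸ 𝔠) a₀ a₁ →
          ∃ (p : ∀ K, Summit.QuantumFields.YangMills.Theorems.AlphaInputsT3AC.PkgAtV3 F (hF ▸ 𝔠) γ hγ hγ1 K),
            (∀ K, (p K).a₀ = a₀ ∧ (p K).a₁ = a₁) ∧
            ∃ (π : Summit.QuantumFields.YangMills.Theorems.AlphaInputsT3AC.PolymerT3 F) (σ : ℕ) (C : ℝ), 7 ≤ σ ∧ 0 ≤ C ∧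
              Summit.QuantumFields.YangMills.Theorems.GlobalSlack.GlobalSupRateTSlack (Summit.QuantumFields.YangMills.Theorems.AlphaInputsT3AC.dataOfV3 p π) (hF ▸ 𝔠).b₀ (hF ▸ 𝔠).p₀ a σ C :=
  globalTwoRunSlackFam_of_k1aLineHonest fun L hLo h7 𝔠 a₀ a₁ ha0 ha1 hw => by
    obtain ⟨a, ha, ha1', hc⟩ := h L hLo h7 𝔠 a₀ a₁ ha0 ha1 hw
    exact ⟨a, ha, ha1', k1aLineHonest_of_chartLineHonest hc⟩


/-! ## §2 Window-free honest form -/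

/-- **THE HONEST K1a CHART ROWS AT THE CANONICAL POLYMERISATION, WINDOW-FREE** — `K1aChartLineHonest` without the three coupling windows (they follow from `γ ≤ gammaW`,
`…CanonicalEndToEnd` §4).  Hypothesis schema; never asserted. [cite: Balaban1985UV3, (7) p.257, (25) p.262, (28) p.263, (34) p.264, (43)-(46) pp.266-267; King1986, Prop. 3.6 (3.56) p.662, Prop. 3.9 (3.71) p.665] -/
def K1aChartRowsHonest (L : ℕ) (𝔠 : AlphaConsts L (suGroupModel 2).N) (a₀ a₁ a : ℝ) : Prop :=
  ∃ (κ C C_E C_R C_s C_B γB : ℝ), 0 < κ ∧ κ ≤ 𝔠.κ ∧ kappa₀ (4 * 2 ^ 3) (2 * 3) ≤ κ ∧ 0 ≤ C ∧ 0 ≤ C_E ∧ 0 ≤ C_R ∧ 0 ≤ C_s ∧ 0 ≤ C_B ∧ 0 < γB ∧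
    L ≤ 𝔠.M₁ ∧
    ∀ (F : T3Family) (γ : ℝ) (hF : F.L = L) (hγ : 0 < γ), γ ≤ γB → ∀ (hγ1 : γ ≤ (min (hF ▸ 𝔠).gamma0 1) ^ 2),
      AlphaInputsT3AC.OfV3At F (hF ▸ 𝔠) a₀ a₁ →
        ∃ (p : ∀ K, AlphaInputsT3AC.PkgAtV3 F (hF ▸ 𝔠) γ hγ hγ1 K), (∀ K, (p K).a₀ = a₀ ∧ (p K).a₁ = a₁) ∧
          ∃ (Φ : ChartFam ↥(lieC (suGroupModel 2)) F) (e : VacFam F) (B : CfgFam ↥(lieC (suGroupModel 2)) F) (R : RemFam F),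
            TaylorSplitΦ (canonPT p) Φ e B R ∧ FlatKernelCauchyΦ (AlphaInputsT3AC.dataOfV3 p (canonPolymer p)) Φ κ a C ∧
            KernelSizeΦg (AlphaInputsT3AC.dataOfV3 p (canonPolymer p)) Φ κ C_E ∧
            RemainderSmallΦ (AlphaInputsT3AC.dataOfV3 p (canonPolymer p)) R (hF ▸ 𝔠).b₀ (hF ▸ 𝔠).p₀ κ C_R ∧
            CfgSizeΦr (AlphaInputsT3AC.dataOfV3 p (canonPolymer p)) B (hF ▸ 𝔠).b₀ (hF ▸ 𝔠).p₀ (hF ▸ 𝔠).r₀ C_s ∧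
            CfgCauchyΦr (AlphaInputsT3AC.dataOfV3 p (canonPolymer p)) B (hF ▸ 𝔠).b₀ (hF ▸ 𝔠).p₀ (hF ▸ 𝔠).r₀ a C_B fun _ => 1

/-- **THE WINDOW-FREE HONEST ROWS GIVE THE HONEST CHART LINE** (threshold `γB ⊓ gammaW L 𝔠 C_s C_B`). [cite: Balaban1985UV3, (7) p.257, p.267] -/
theorem k1aChartLineHonest_of_chartRowsHonest {L : ℕ} {𝔠 : AlphaConsts L (suGroupModel 2).N} {a₀ a₁ a : ℝ} (h : K1aChartRowsHonest L 𝔠 a₀ a₁ a) :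
    K1aChartLineHonest L 𝔠 a₀ a₁ a := by
  obtain ⟨κ, C, C_E, C_R, C_s, C_B, γB, hκ0, hκle, hκ₀, hC, hCE, hCR, hCs, hCB, hγB, hM, hall⟩ := h
  refine ⟨κ, C, C_E, C_R, C_s, C_B, min γB (gammaW L 𝔠 C_s C_B), hκ0, hκle, hκ₀, hC, hCE, hCR, hCs, hCB, lt_min hγB (gammaW_pos L 𝔠 C_s C_B), hM,
    fun F γ hF hγ hγle hγ1 hOf => ?_⟩
  subst hF
  have hγB' : γ ≤ γB := hγle.trans (min_le_left _ _)
  have hW : γ ≤ gammaW F.L 𝔠 C_s C_B := hγle.trans (min_le_right _ _)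
  have h0 : γ ≤ gammaθ 𝔠.b₀ 𝔠.p₀ (1 / max 1 (C_s + C_B)) := hW.trans (min_le_left _ _)
  have h1 : γ ≤ gammaθ 𝔠.b₀ (𝔠.p₀ + 𝔠.r₀) (𝔠.ρ / (4 * max 1 𝔠.cB)) := hW.trans ((min_le_right _ _).trans (min_le_left _ _))
  have h2 : γ ≤ gammaθ 𝔠.b₀ 𝔠.p₀ (1 / (2 * (8 * ((F.L : ℝ) + 1) ^ 2 * 𝔠.B₃ * 𝔠.Zfull))) := hW.trans ((min_le_right _ _).trans (min_le_right _ _))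
  have hγ1' : γ ≤ 1 := hγ1.trans (sq_min_one_le _ 𝔠.gamma0_pos)
  obtain ⟨p, hp, Φ, e, B, R, hT, hK, hE, hR, hS, hBC⟩ := hall F γ rfl hγ hγB' hγ1 hOf
  exact ⟨fun n => window_sum_le_one F.hL.2.le 𝔠.b₀_pos 𝔠.p₀_pos hγ hγ1' h0 n,
    fun K k hk => window_jet (hγ := hγ) (hγ1 := hγ1) h1 K k hk, fun K k hk => window_oldSlice (hγ := hγ) (hγ1 := hγ1) h2 K k hk,
    p, hp, Φ, e, B, R, hT, hK, hE, hR, hS, hBC⟩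

/-- **THE REGISTERED STUB 3⁗ FROM THE SIX HONEST CHART ROWS ALONE (WINDOW-FREE), BY NAME** (`globalTwoRunSlackFam_of_k1aChartLineHonest ∘
k1aChartLineHonest_of_chartRowsHonest`; rate `a/2`, σ = 7, profile `θBal(b₀,p₀)`). [cite: King1986, Thm 3.4 (3.9) p.656, Prop. 3.6 p.662; Balaban1985UV3, (7) p.257, (28) p.263, (34) p.264, (43)-(46) pp.266-267, (57) p.270] -/
theorem globalTwoRunSlackFam_of_k1aChartRowsHonest
    (h : ∀ (L : ℕ), Odd L → 7 ≤ L → ∀ (𝔠 : AlphaConsts L (suGroupModel 2).N) (a₀ a₁ : ℝ), 0 < a₀ → 0 < a₁ → 𝔠.B₃ * a₁ ≤ a₀ →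
      ∃ a : ℝ, 0 < a ∧ a < 1 ∧ K1aChartRowsHonest L 𝔠 a₀ a₁ a) :
    ∀ (L : ℕ), Odd L → 7 ≤ L → ∀ (𝔠 : Summit.QuantumFields.Balaban3D.Proofs.Primitives.AlphaConsts L (Summit.QuantumFields.Balaban3D.Carriers.suGroupModel 2).N)
      (a₀ a₁ : ℝ), 0 < a₀ → 0 < a₁ → 𝔠.B₃ * a₁ ≤ a₀ →
      ∃ a : ℝ, 0 < a ∧ ∃ γB : ℝ, 0 < γB ∧ ∀ (F : T3Family) (γ : ℝ) (hF : F.L = L) (hγ : 0 < γ), γ ≤ γB →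
        ∀ (hγ1 : γ ≤ (min (hF ▸ 𝔠).gamma0 1) ^ 2),
          Summit.QuantumFields.YangMills.Theorems.AlphaInputsT3AC.OfV3At F (hF ▸ 𝔠) a₀ a₁ →
          ∃ (p : ∀ K, Summit.QuantumFields.YangMills.Theorems.AlphaInputsT3AC.PkgAtV3 F (hF ▸ 𝔠) γ hγ hγ1 K),
            (∀ K, (p K).a₀ = a₀ ∧ (p K).a₁ = a₁) ∧
            ∃ (π : Summit.QuantumFields.YangMills.Theorems.AlphaInputsT3AC.PolymerT3 F) (σ : ℕ) (C : ℝ), 7 ≤ σ ∧ 0 ≤ C ∧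
              Summit.QuantumFields.YangMills.Theorems.GlobalSlack.GlobalSupRateTSlack (Summit.QuantumFields.YangMills.Theorems.AlphaInputsT3AC.dataOfV3 p π) (hF ▸ 𝔠).b₀ (hF ▸ 𝔠).p₀ a σ C :=
  globalTwoRunSlackFam_of_k1aChartLineHonest fun L hLo h7 𝔠 a₀ a₁ ha0 ha1 hw => by
    obtain ⟨a, ha, ha1', hc⟩ := h L hLo h7 𝔠 a₀ a₁ ha0 ha1 hw
    exact ⟨a, ha, ha1', k1aChartLineHonest_of_chartRowsHonest hc⟩

end Summit.QuantumFields.YangMills.Theorems.GlobalSlackCanonicalPolymers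

end
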